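import Summits.ValiantsHypothesis.ValiantsHypothesis.Theorems.PolyaContinuedLaplaceRigiditySingCodimEight
import Mathlib.RingTheory.Localization.FractionRing

/-!
# Top-dimensional components of `Sing(per₄)` have a zero line

Helper file for crux `CoverDecancellation` (stmt-ValiantsHypothesis-17819), line `laplace_rigidity`,
rung row R3 (`str₂(per₄)`).  By `…StrengthEquality.perFour_width_four_exists_prime_subperm` a width-4
decomposition `per₄ = Σ_{i<4} pᵢ qᵢ` into products of quadrics forces all `pᵢ, qᵢ` into a prime `P`
of height EXACTLY `8 = codim Sing(per₄)` over the `3 × 3` sub-permanents of the generic `4 × 4`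
matrix — a top-dimensional irreducible component of `Sing(per₄)`.  This file proves the first
structural fact about such components, WITHOUT classifying them:

* `trdeg_le_seven_of_antiblock`, `trdeg_le_seven_of_cross` — a `4 × 4` point `z` over a field
  `L ⊇ F` with vanishing `3 × 3` sub-permanents whose support is confined to an anti-block pattern
  (zero on `I × J ∪ Iᶜ × Jᶜ`, `|I| = |J| = 2`) or to a cross `row i₀ ∪ column j₀` has
  `trdeg_F F[z] ≤ 7` (anti-block: the sub-permanent `z_{i₂ j₃} · per₂(Iᶜ × J)` vanishes, so either
  the `Iᶜ × J` block satisfies a non-trivial quadratic relation or the `I × Jᶜ` block is zero;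
  cross: seven cells);
* `row_or_col_eq_zero_of_lt_trdeg` — hence (support theorem
  `…SupportPatterns.support_of_subperm_vanish`, val-idea-10 g2) a point of `Sing(per₄)` with
  `trdeg_F F[z] > 7` has a ZERO ROW or a ZERO COLUMN;
* **`row_or_col_subset_of_height_le_eight`** — every prime `P ⊇ subpermIdeal F 4 4 3` with
  `height P ≤ 8` (hence `= 8`, `…SingCodim.eight_le_height_of_subpermIdeal_four_le`) contains all four
  variables of some row or all four variables of some column (`2 ≠ 0`, `3 ≠ 0` in `F`): generic
  point in `Frac(F[X]/P)` and the bridge `…Tools.natCast_sub_le_height_ker_aeval` (`trdeg ≤ 7` would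
  give `height ≥ 9`);
* `row_or_col_subset_of_singPermIdeal_four_le` — the same for the height-`8`
  primes over `singPermIdeal F 4 = (per₄, ∂per₄/∂x_ij)`, and `perFour_width_four_zero_line` — the
  consumer form: the prime carrying a width-4 quadric decomposition of `per₄` over `ℂ` contains a
  full row or a full column of variables.

So the top-dimensional components of `Sing(per₄)` are `{row i = 0} × C` / `{col j = 0} × C` for
8-dimensional components `C` of `P_{3,4}` (three rows, all `3 × 3` sub-permanents zero) — the
reduction used by every version of the «component» attack on `str₂(per₄) ≥ 5`.

Honest framing: structure lemmas only; `str₂(per₄) ≥ 5`, `StrengthTwoPerFour` (stmt-25160),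
`CentralLaplaceRigidity`, `CoverDecancellation` and VP ≠ VNP are OPEN and NOT moved; no summit
statement is touched.  val-width-17819-w1 g2, 2026-08-28.

References: J. Alper, T. Bogart, M. Velasco, Found. Comput. Math. 17 (2017), §1 and Rem. 1.5
[AlperBogartVelasco2017]; A. Boralevi, E. Carlini, M. Michałek, E. Ventura, Adv. Math. 461 (2025),
Prop. 3.10 [BoraleviCarliniMichalekVentura2025].
-/

set_option linter.dupNamespace false

noncomputable section

namespace Summit.ValiantsHypothesis.ValiantsHypothesis.Theorems.PolyaContinuedLaplaceRigidity.SingCodim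

open MvPolynomial Cardinal Matrix
open Summit.ValiantsHypothesis.ValiantsHypothesis.Theorems.SymPencilPerFourHessianRankThreeZero (eq_or_of_four)
open Literature.Computability.AlgebraicComplexity
open Literature.Computability.AlgebraicComplexity.BoraleviCarliniMichalekVentura2025
open Summit.ValiantsHypothesis.ValiantsHypothesis.Theorems.SymPencilPerFourSingularLocusSupportPatterns

variable {F : Type*} [Field F] {L : Type*} [Field L] [Algebra F L]

/-! ### Counting cells -/

/-- A cross `row i₀ ∪ column j₀` has seven cells. -/
theorem card_filter_cross_le_seven (i₀ j₀ : Fin 4) :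
    (Finset.univ.filter fun x : Fin 4 × Fin 4 => x.1 = i₀ ∨ x.2 = j₀).card ≤ 7 := by
  revert i₀ j₀; decide

/-- In `Fin 4`, an index different from `i₁, i₂` is one of the two others. -/
theorem eq_or_eq_of_ne_of_ne {i₁ i₂ i₃ i₄ : Fin 4} (h₁₂ : i₁ ≠ i₂) (h₁₃ : i₁ ≠ i₃) (h₁₄ : i₁ ≠ i₄)
    (h₂₃ : i₂ ≠ i₃) (h₂₄ : i₂ ≠ i₄) (h₃₄ : i₃ ≠ i₄) {x : Fin 4} (hx : ¬ (x = i₁ ∨ x = i₂)) :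
    x = i₃ ∨ x = i₄ := by
  rcases eq_or_of_four i₁ i₂ i₃ i₄ h₁₂ h₁₃ h₁₄ h₂₃ h₂₄ h₃₄ x with h | h | h | h
  · exact absurd (Or.inl h) hx
  · exact absurd (Or.inr h) hx
  · exact Or.inl h
  · exact Or.inr h

/-- The quadratic relation `X₀ X₃ + X₁ X₂` is a non-zero polynomial. [folklore] -/
theorem perTwoRel_ne_zero :
    (X 0 * X 3 + X 1 * X 2 : MvPolynomial (Fin 4) F) ≠ 0 := by
  intro h
  have hc := congrArg (coeff (Finsupp.single 0 1 + Finsupp.single 3 1)) h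
  rw [coeff_add, coeff_zero] at hc
  have h1 : coeff (Finsupp.single (0 : Fin 4) 1 + Finsupp.single 3 1)
      (X 0 * X 3 : MvPolynomial (Fin 4) F) = 1 := by
    rw [X, X, monomial_mul, coeff_monomial, if_pos rfl, mul_one]
  have h2 : coeff (Finsupp.single (0 : Fin 4) 1 + Finsupp.single 3 1)
      (X 1 * X 2 : MvPolynomial (Fin 4) F) = 0 := by
    rw [X, X, monomial_mul, coeff_monomial, if_neg]
    intro heq
    have := DFunLike.congr_fun heq 0
    simp at this
  rw [h1, h2, add_zero] at hc
  exact one_ne_zero hc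

section Point

variable (z : Fin 4 × Fin 4 → L)

/-- **Anti-block support forces `trdeg ≤ 7`.**  If `z` vanishes on `I × J ∪ Iᶜ × Jᶜ`
(`I = {i₁, i₂}`, `J = {j₁, j₂}`) and its `3 × 3` sub-permanents vanish, then `trdeg_F F[z] ≤ 7`:
the sub-permanents `z_{i j₃} · per₂(Iᶜ × J)` (`i ∈ I`, `j₃ ∉ J`) vanish, so either the four entries
of the `Iᶜ × J` block satisfy `c₀ c₃ + c₁ c₂ = 0` (three of them carry the block) or the `I × Jᶜ`
block is zero (four non-zero cells remain). [cite: AlperBogartVelasco2017, Rem. 1.5] -/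
theorem trdeg_le_seven_of_antiblock {i₁ i₂ j₁ j₂ : Fin 4} (hi : i₁ ≠ i₂) (hj : j₁ ≠ j₂)
    (hz : ∀ i j : Fin 4, ((i = i₁ ∨ i = i₂) ↔ (j = j₁ ∨ j = j₂)) → z (i, j) = 0)
    (hvan : ∀ r₀ r₁ r₂ c₀ c₁ c₂ : Fin 4, r₀ ≠ r₁ → r₀ ≠ r₂ → r₁ ≠ r₂ → c₀ ≠ c₁ → c₀ ≠ c₂ →
      c₁ ≠ c₂ →
      z (r₀, c₀) * (z (r₁, c₁) * z (r₂, c₂) + z (r₁, c₂) * z (r₂, c₁)) +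
        z (r₀, c₁) * (z (r₁, c₀) * z (r₂, c₂) + z (r₁, c₂) * z (r₂, c₀)) +
        z (r₀, c₂) * (z (r₁, c₀) * z (r₂, c₁) + z (r₁, c₁) * z (r₂, c₀)) = 0) :
    Algebra.trdeg F (Algebra.adjoin F (Set.range z)) ≤ 7 := by
  classical
  obtain ⟨i₃, i₄, h₃₄, h₃₁, h₃₂, h₄₁, h₄₂⟩ := exists_two_others i₁ i₂ hi
  obtain ⟨j₃, j₄, k₃₄, k₃₁, k₃₂, k₄₁, k₄₂⟩ := exists_two_others j₁ j₂ hj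
  -- the two blocks
  set c : Fin 4 → L := ![z (i₃, j₁), z (i₃, j₂), z (i₄, j₁), z (i₄, j₂)] with hc
  set b : Fin 4 → L := ![z (i₁, j₃), z (i₁, j₄), z (i₂, j₃), z (i₂, j₄)] with hb
  set π : L := z (i₃, j₁) * z (i₄, j₂) + z (i₃, j₂) * z (i₄, j₁) with hπ
  -- zero cells in `I × J`
  have hz₁₁ : z (i₁, j₁) = 0 := hz i₁ j₁ (by simp)
  have hz₁₂ : z (i₁, j₂) = 0 := hz i₁ j₂ (by simp)
  have hz₂₁ : z (i₂, j₁) = 0 := hz i₂ j₁ (by simp)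
  have hz₂₂ : z (i₂, j₂) = 0 := hz i₂ j₂ (by simp)
  -- the four product relations `b_k · π = 0`
  have hrel : ∀ i c₀ : Fin 4, (i = i₁ ∨ i = i₂) → i ≠ i₃ → i ≠ i₄ → c₀ ≠ j₁ → c₀ ≠ j₂ →
      z (i, c₀) * π = 0 := by
    intro i c₀ hiI hi₃ hi₄ hc₁ hc₂
    have hzi₁ : z (i, j₁) = 0 := hz i j₁ (by simp [hiI])
    have hzi₂ : z (i, j₂) = 0 := hz i j₂ (by simp [hiI])
    have h := hvan i i₃ i₄ c₀ j₁ j₂ hi₃ hi₄ h₃₄ hc₁ hc₂ hj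
    rw [hzi₁, hzi₂, zero_mul, zero_mul, add_zero, add_zero] at h
    rw [hπ]
    exact h
  -- every coordinate is zero, in the `c`-block, or in the `b`-block
  have hcover : ∀ x : Fin 4 × Fin 4, z x = 0 ∨ z x ∈ Set.range c ∨ z x ∈ Set.range b := by
    rintro ⟨x, y⟩
    by_cases hxy : (x = i₁ ∨ x = i₂) ↔ (y = j₁ ∨ y = j₂)
    · exact Or.inl (hz x y hxy)
    · rw [not_iff] at hxy
      by_cases hx : x = i₁ ∨ x = i₂
      · -- `x ∈ I`, `y ∉ J`: the `b`-block
        have hy : ¬ (y = j₁ ∨ y = j₂) := fun h => (hxy.2 h) hx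
        rcases hx with rfl | rfl <;>
          rcases eq_or_eq_of_ne_of_ne hj k₃₁.symm k₄₁.symm k₃₂.symm k₄₂.symm k₃₄ hy with rfl | rfl
        · exact Or.inr (Or.inr ⟨0, by simp [hb]⟩)
        · exact Or.inr (Or.inr ⟨1, by simp [hb]⟩)
        · exact Or.inr (Or.inr ⟨2, by simp [hb]⟩)
        · exact Or.inr (Or.inr ⟨3, by simp [hb]⟩)
      · -- `x ∉ I`, `y ∈ J`: the `c`-block
        have hy : y = j₁ ∨ y = j₂ := hxy.1 hx
        rcases eq_or_eq_of_ne_of_ne hi h₃₁.symm h₄₁.symm h₃₂.symm h₄₂.symm h₃₄ hx with rfl | rfl <;>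
          rcases hy with rfl | rfl
        · exact Or.inr (Or.inl ⟨0, by simp [hc]⟩)
        · exact Or.inr (Or.inl ⟨1, by simp [hc]⟩)
        · exact Or.inr (Or.inl ⟨2, by simp [hc]⟩)
        · exact Or.inr (Or.inl ⟨3, by simp [hc]⟩)
  by_cases hπ0 : π = 0
  · -- the `c`-block satisfies `c₀ c₃ + c₁ c₂ = 0`: `trdeg F[c] ≤ 3`
    have hc3 : Algebra.trdeg F (Algebra.adjoin F (Set.range c)) ≤ 3 := by
      refine trdeg_adjoin_range_le_of_aeval_eq_zero (F := F) c (perTwoRel_ne_zero (F := F)) ?_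
      simp only [map_add, map_mul, aeval_X, hc]
      simp only [Matrix.cons_val_zero, Matrix.cons_val_one, Matrix.cons_val]
      rw [← hπ0, hπ]
    have h := trdeg_adjoin_le_of_cover_add (F := F) (U := Set.range z) hc3 b fun e he => ?_
    · exact h.trans (by norm_num)
    · obtain ⟨x, rfl⟩ := he
      rcases hcover x with h0 | hcx | hbx
      · exact alg_of_eq_zero _ h0
      · exact alg_of_mem (Or.inl hcx)
      · exact alg_of_mem (Or.inr hbx)
  · -- the `b`-block vanishes: four cells carry everything
    have hb0 : ∀ x : Fin 4 × Fin 4, z x ∈ Set.range b → z x = 0 := by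
      intro x hx
      obtain ⟨k, hk⟩ := hx
      rw [← hk]
      have hk' : ∀ k : Fin 4, b k * π = 0 := by
        intro k
        fin_cases k
        · simpa [hb] using hrel i₁ j₃ (Or.inl rfl) h₃₁.symm h₄₁.symm k₃₁ k₃₂
        · simpa [hb] using hrel i₁ j₄ (Or.inl rfl) h₃₁.symm h₄₁.symm k₄₁ k₄₂
        · simpa [hb] using hrel i₂ j₃ (Or.inr rfl) h₃₂.symm h₄₂.symm k₃₁ k₃₂
        · simpa [hb] using hrel i₂ j₄ (Or.inr rfl) h₃₂.symm h₄₂.symm k₄₁ k₄₂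
      exact (mul_eq_zero.1 (hk' k)).resolve_right hπ0
    have h := trdeg_adjoin_le_of_cover (F := F) (U := Set.range z) c fun e he => ?_
    · exact h.trans (by norm_num)
    · obtain ⟨x, rfl⟩ := he
      rcases hcover x with h0 | hcx | hbx
      · exact alg_of_eq_zero _ h0
      · exact alg_of_mem hcx
      · exact alg_of_eq_zero _ (hb0 x hbx)

/-- **Cross support forces `trdeg ≤ 7`**: a point supported on `row i₀ ∪ column j₀` has at most
seven non-zero coordinates. [cite: AlperBogartVelasco2017, Rem. 1.5] -/
theorem trdeg_le_seven_of_cross {i₀ j₀ : Fin 4} (hz : ∀ i j : Fin 4, i ≠ i₀ → j ≠ j₀ → z (i, j) = 0) :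
    Algebra.trdeg F (Algebra.adjoin F (Set.range z)) ≤ 7 := by
  classical
  set T : Finset (Fin 4 × Fin 4) := Finset.univ.filter fun x : Fin 4 × Fin 4 =>
    x.1 = i₀ ∨ x.2 = j₀ with hT
  refine trdeg_adjoin_le_nat_of_forall_alg (T := T.image z)
    (Finset.card_image_le.trans (card_filter_cross_le_seven i₀ j₀)) fun e he => ?_
  obtain ⟨x, rfl⟩ := he
  by_cases hx : x.1 = i₀ ∨ x.2 = j₀
  · refine alg_of_mem ?_
    rw [Finset.coe_image]
    exact ⟨x, by simp [hT, hx], rfl⟩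
  · push Not at hx
    exact alg_of_eq_zero _ (hz x.1 x.2 hx.1 hx.2)

/-- **A point of `Sing(per₄)` with `trdeg_F F[z] > 7` has a zero row or a zero column** (`2 ≠ 0`,
`3 ≠ 0`): by the support theorem the alternatives are an anti-block or a cross support, both of
transcendence degree `≤ 7`. [cite: AlperBogartVelasco2017, §1 (arXiv text p0003 L38)] -/
theorem row_or_col_eq_zero_of_lt_trdeg (h2 : (2 : L) ≠ 0) (h3 : (3 : L) ≠ 0)
    (hvan : ∀ r₀ r₁ r₂ c₀ c₁ c₂ : Fin 4, r₀ ≠ r₁ → r₀ ≠ r₂ → r₁ ≠ r₂ → c₀ ≠ c₁ → c₀ ≠ c₂ →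
      c₁ ≠ c₂ →
      z (r₀, c₀) * (z (r₁, c₁) * z (r₂, c₂) + z (r₁, c₂) * z (r₂, c₁)) +
        z (r₀, c₁) * (z (r₁, c₀) * z (r₂, c₂) + z (r₁, c₂) * z (r₂, c₀)) +
        z (r₀, c₂) * (z (r₁, c₀) * z (r₂, c₁) + z (r₁, c₁) * z (r₂, c₀)) = 0)
    (htr : ¬ Algebra.trdeg F (Algebra.adjoin F (Set.range z)) ≤ 7) :
    (∃ i : Fin 4, ∀ j : Fin 4, z (i, j) = 0) ∨ (∃ j : Fin 4, ∀ i : Fin 4, z (i, j) = 0) := by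
  classical
  have h12 : (12 : L) ≠ 0 := by
    rw [show (12 : L) = 2 * 2 * 3 by norm_num]
    exact mul_ne_zero (mul_ne_zero h2 h2) h3
  set M : Matrix (Fin 4) (Fin 4) L := Matrix.of fun i j => z (i, j) with hM
  have hmat : ∀ r c : Fin 4, (M.submatrix r.succAbove c.succAbove).permanent = 0 := by
    intro r c
    obtain ⟨j, k, l, hrj, hrk, hrl, hjk, hjl, hkl⟩ := exists_three_others r
    obtain ⟨b, c', d, hcb, hcc, hcd', hbc, hbd, hcd⟩ := exists_three_others c
    rw [permanent_submatrix_succAbove_eq M hrj hrk hrl hjk hjl hkl hcb hcc hcd' hbc hbd hcd]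
    simp only [hM, Matrix.of_apply]
    exact hvan j k l b c' d hjk hjl hkl hbc hbd hcd
  rcases support_of_subperm_vanish (R := L) h12 M hmat with
    ⟨i, hi⟩ | ⟨j, hj⟩ | ⟨i₁, i₂, j₁, j₂, hi, hj, hz⟩ | ⟨i₀, j₀, hz⟩
  · exact Or.inl ⟨i, fun j => by simpa [hM] using hi j⟩
  · exact Or.inr ⟨j, fun i => by simpa [hM] using hj i⟩
  · exact absurd (trdeg_le_seven_of_antiblock (F := F) z hi hj
      (fun i j hij => by simpa [hM] using hz i j hij) hvan) htr
  · exact absurd (trdeg_le_seven_of_cross (F := F) z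
      (fun i j hi hj => by simpa [hM] using hz i j hi hj)) htr

end Point

/-! ### The ideal statements -/

/-- **Every prime of height `≤ 8` over the `3 × 3` sub-permanents of the generic `4 × 4` matrix
contains a full row or a full column of variables** (`2 ≠ 0`, `3 ≠ 0` in `F`).  These are exactly
the primes of the top-dimensional (8-dimensional) components of `Sing(per₄)`
(`eight_le_height_of_subpermIdeal_four_le`).  Proof: the generic point `z` of `P` in
`Frac(F[X]/P)` has `height P ≥ 16 - trdeg_F F[z]`, so `trdeg > 7`, and
`row_or_col_eq_zero_of_lt_trdeg` applies; a zero coordinate of `z` is a variable in `P`.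
[cite: AlperBogartVelasco2017, §1 (arXiv text p0003 L38) and Rem. 1.5] -/
theorem row_or_col_subset_of_height_le_eight (F : Type*) [Field F] (h2 : (2 : F) ≠ 0)
    (h3 : (3 : F) ≠ 0) (P : Ideal (MvPolynomial (Fin 4 × Fin 4) F)) [hP : P.IsPrime]
    (hle : subpermIdeal F 4 4 3 ≤ P) (h8 : P.height ≤ 8) :
    (∃ i : Fin 4, ∀ j : Fin 4, (X (i, j) : MvPolynomial (Fin 4 × Fin 4) F) ∈ P) ∨
      (∃ j : Fin 4, ∀ i : Fin 4, (X (i, j) : MvPolynomial (Fin 4 × Fin 4) F) ∈ P) := by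
  classical
  haveI : IsDomain (MvPolynomial (Fin 4 × Fin 4) F ⧸ P) := Ideal.Quotient.isDomain P
  let Lf := FractionRing (MvPolynomial (Fin 4 × Fin 4) F ⧸ P)
  let z : Fin 4 × Fin 4 → Lf := fun x =>
    algebraMap (MvPolynomial (Fin 4 × Fin 4) F ⧸ P) Lf (Ideal.Quotient.mk P (X x))
  have haeval : ∀ p : MvPolynomial (Fin 4 × Fin 4) F,
      aeval z p = algebraMap _ Lf (Ideal.Quotient.mk P p) := by
    intro p
    have h : (aeval (R := F) z : MvPolynomial (Fin 4 × Fin 4) F →ₐ[F] Lf) =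
        (IsScalarTower.toAlgHom F (MvPolynomial (Fin 4 × Fin 4) F ⧸ P) Lf).comp
          (Ideal.Quotient.mkₐ F P) :=
      MvPolynomial.algHom_ext fun x => by simp [z]
    exact congrArg (fun φ : MvPolynomial (Fin 4 × Fin 4) F →ₐ[F] Lf => φ p) h
  have hker : RingHom.ker (aeval (R := F) z) = P := by
    ext p
    rw [RingHom.mem_ker, haeval, map_eq_zero_iff _ (IsFractionRing.injective _ _),
      Ideal.Quotient.eq_zero_iff_mem]
  -- a zero coordinate of `z` is a variable in `P`
  have hzero : ∀ x : Fin 4 × Fin 4, z x = 0 → (X x : MvPolynomial (Fin 4 × Fin 4) F) ∈ P := by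
    intro x hx
    rw [← hker, RingHom.mem_ker, aeval_X]
    exact hx
  -- the sub-permanents vanish at `z`
  have hvan : ∀ r₀ r₁ r₂ c₀ c₁ c₂ : Fin 4, r₀ ≠ r₁ → r₀ ≠ r₂ → r₁ ≠ r₂ → c₀ ≠ c₁ → c₀ ≠ c₂ →
      c₁ ≠ c₂ →
      z (r₀, c₀) * (z (r₁, c₁) * z (r₂, c₂) + z (r₁, c₂) * z (r₂, c₁)) +
        z (r₀, c₁) * (z (r₁, c₀) * z (r₂, c₂) + z (r₁, c₂) * z (r₂, c₀)) +
        z (r₀, c₂) * (z (r₁, c₀) * z (r₂, c₁) + z (r₁, c₁) * z (r₂, c₀)) = 0 := by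
    intro r₀ r₁ r₂ c₀ c₁ c₂ h₀₁ h₀₂ h₁₂ k₀₁ k₀₂ k₁₂
    have hRc : ({r₀, r₁, r₂} : Finset (Fin 4)).card = 3 := by
      rw [Finset.card_insert_of_notMem (by simp [h₀₁, h₀₂]), Finset.card_pair h₁₂]
    have hCc : ({c₀, c₁, c₂} : Finset (Fin 4)).card = 3 := by
      rw [Finset.card_insert_of_notMem (by simp [k₀₁, k₀₂]), Finset.card_pair k₁₂]
    have hmem : rsubperm (mvPolynomialX (Fin 4) (Fin 4) F) (· ∈ ({c₀, c₁, c₂} : Finset (Fin 4)))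
        (· ∈ ({r₀, r₁, r₂} : Finset (Fin 4))) ∈ P :=
      hle (rsubperm_mem_subpermIdeal hRc hCc)
    rw [← hker, RingHom.mem_ker, aeval_rsubperm_X,
      AlperBogartVelasco.rsubperm_triple _ h₀₁ h₀₂ h₁₂ k₀₁ k₀₂ k₁₂]
      at hmem
    simpa only [Matrix.of_apply] using hmem
  have h2L : (2 : Lf) ≠ 0 := by
    intro h
    apply h2
    have hinj := (algebraMap F Lf).injective
    apply hinj
    rw [map_ofNat, map_zero, h]
  have h3L : (3 : Lf) ≠ 0 := by
    intro h
    apply h3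
    have hinj := (algebraMap F Lf).injective
    apply hinj
    rw [map_ofNat, map_zero, h]
  -- `trdeg > 7`, else `height ≥ 9`
  have htr : ¬ Algebra.trdeg F (Algebra.adjoin F (Set.range z)) ≤ 7 := by
    intro h7
    have h9 := natCast_sub_le_height_ker_aeval (F := F) z (d := 7) h7
    rw [hker] at h9
    have h9' : (9 : ℕ∞) ≤ P.height := by simpa using h9
    have : (9 : ℕ∞) ≤ 8 := h9'.trans h8
    exact absurd this (by norm_num)
  rcases row_or_col_eq_zero_of_lt_trdeg (F := F) z h2L h3L hvan htr with ⟨i, hi⟩ | ⟨j, hj⟩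
  · exact Or.inl ⟨i, fun j => hzero (i, j) (hi j)⟩
  · exact Or.inr ⟨j, fun i => hzero (i, j) (hj i)⟩

/-- **Top-dimensional components of `Sing(per₄)` have a zero line**: every minimal prime of
`singPermIdeal F 4 = (per₄, ∂per₄/∂x_ij)` of height `≤ 8` contains a full row or a full column of
variables (`2 ≠ 0`, `3 ≠ 0`).  (All minimal primes have height `≥ 8`,
`eight_le_height_singPermIdeal_four`; those of height `8` are the top-dimensional components, and
`Rem. 1.5`'s two-zero-rows components show they exist.)
[cite: AlperBogartVelasco2017, §1 (arXiv text p0003 L38) and Rem. 1.5] -/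
theorem row_or_col_subset_of_singPermIdeal_four_le (F : Type*) [Field F] (h2 : (2 : F) ≠ 0)
    (h3 : (3 : F) ≠ 0) (P : Ideal (MvPolynomial (Fin 4 × Fin 4) F)) [P.IsPrime]
    (hle : VonZurGathen.singPermIdeal F 4 ≤ P) (h8 : P.height ≤ 8) :
    (∃ i : Fin 4, ∀ j : Fin 4, (X (i, j) : MvPolynomial (Fin 4 × Fin 4) F) ∈ P) ∨
      (∃ j : Fin 4, ∀ i : Fin 4, (X (i, j) : MvPolynomial (Fin 4 × Fin 4) F) ∈ P) := by
  rw [singPermIdeal_eq_subpermIdeal F (m := 4) (by norm_num)] at hle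
  exact row_or_col_subset_of_height_le_eight F h2 h3 P hle h8

/-- **Consumer form for line `laplace_rigidity` (rung row R3, width 4).**  If
`per₄ = Σ_{i<4} pᵢ qᵢ` with `pᵢ, qᵢ` homogeneous quadrics over `ℂ`, then there is a prime `P` of
height `8` over the `3 × 3` sub-permanents containing all `pᵢ, qᵢ` AND all four variables of some
row or of some column.  (`…Strength.perFour_width_four_exists_prime_subperm` is the input; this
file adds the zero line.) [cite: GesmundoGhosalIkenmeyerLysikov2022, Prop. 6] -/
theorem perFour_width_four_zero_line (p q : Fin 4 → MvPolynomial (Fin 4 × Fin 4) ℂ)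
    (hpq : (∀ i, (p i).IsHomogeneous 2) ∧ (∀ i, (q i).IsHomogeneous 2) ∧
      perPoly (Fin 4) ℂ = ∑ i, p i * q i)
    (P : Ideal (MvPolynomial (Fin 4 × Fin 4) ℂ)) [P.IsPrime]
    (hle : subpermIdeal ℂ 4 4 3 ≤ P) (h8 : P.height = 8) (hp : ∀ i, p i ∈ P) (hq : ∀ i, q i ∈ P) :
    ((∃ i : Fin 4, ∀ j : Fin 4, (X (i, j) : MvPolynomial (Fin 4 × Fin 4) ℂ) ∈ P) ∨
      (∃ j : Fin 4, ∀ i : Fin 4, (X (i, j) : MvPolynomial (Fin 4 × Fin 4) ℂ) ∈ P)) ∧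
      (∀ i, p i ∈ P) ∧ (∀ i, q i ∈ P) ∧ perPoly (Fin 4) ℂ = ∑ i, p i * q i :=
  ⟨row_or_col_subset_of_height_le_eight ℂ (by norm_num) (by norm_num) P hle h8.le, hp, hq, hpq.2.2⟩

end Summit.ValiantsHypothesis.ValiantsHypothesis.Theorems.PolyaContinuedLaplaceRigidity.SingCodim

end
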